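import Literature.MathematicalPhysics.QuantumFieldTheory.Balaban1983to89.B8Ineq159TopCubeTowerSourceReads
import Literature.MathematicalPhysics.QuantumFieldTheory.Balaban1983to89.B8SockB9P3H2AtTopCubeTower

/-!
# `Balaban1983to89.B8Ineq159TopCubeTowerSourcePoint` — [Balaban1985RegularSpaces] (1.146) p. 101, (1.57)–(1.59) p. 86, (1.38) p. 82, (1.131) p. 99: A POINTWISE
# BOUND `η|A′| ≤ P₀N + P₁s` FOR A FIELD IN THE SOURCED LANDAU GAUGE (1.146) AT PRINT'S TOP-CUBE TOWER, PER MEMBER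

statement-level skeleton of published theorems with citation tags; proofs where landed; nothing here is a claim about the
Yang–Mills mass gap

`[Balaban1985RegularSpaces]` ("B8", CMP **99** (1985) 75–102) (1.146) p. 101 («R(U₀)D^{η*}_{U₀}A = f»), (1.57)–(1.59) p. 86, (1.36)–(1.38) p. 82, (1.7) p. 77, (1.131) p. 99;
[4] = `[Balaban1985BackgroundPropagators]` Thm 3.3 p. 399; [B7] = `[Balaban1985Averaging]` (127) p. 37, Prop. 5 p. 42.

CITATION HEADER (lean-in-tree rule).  Cell `pub-ymgap` (YM Track A, HUMAN RULING D-0062 ∕ D-0149), node N05 = [B8], width seat `pub-ymgap-dag-n05-w3` (g4), CLAIM-2 file (E1);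
the step between `B8Ineq159TopCubeTowerSourceReads` (reads) and `B8SockB9P3SrcAtTopCubeTower` (the P₂D slot's SOURCED binder `SB9srcHP` at the top-cube tower).

THE MATHEMATICS (kernel-checked).  ★★ `exists_pointBound_src_topCube`: for `d ≥ 2`, `2 ≤ L ≤ ρ`, `k ≥ 1` and a finite-dimensional C⋆-algebra `𝔹` there are
`cP3 ∈ (0, ½]`, `P₀, P₁ > 0` (depending on `L, M, ρ, k, d, 𝔹`) such that for every position `a`, `η > 0`, restriction family `Λ` of print's shape, unitary
`U₀ ∈ 𝔄_k(cP3)` over `(T, □₁, …, □_k)`, every field `A′`, source `f` with `η²|f| ≤ s` and `A′` in the SOURCED Landau gauge `Δ_{U₀}(D^{η*}_{U₀}A′ − f) = Q^{T*}μ`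
((1.146) unfolded), and every `N ≥ (Lʲη)³|J(A′)|` on the bonds touching `Ω_j`, `N ≥ |class averages of iηA′|` on `towerBondsP`: `η|A′| ≤ P₀N + P₁s` at EVERY bond and
`(Lʲη)|A′| ≤ P₀N + P₁s` on the sides of the plaquettes touching `□_j`, `1 ≤ j ≤ k`.  PROOF ROAD: the line-integral divergence potential `A″` of `f`
(`exists_divPotential`) cut off to the sides `S` of the plaquettes touching `□₀` (`η|A″| ≤ W(□)s` there, `W(□) = LᵏM + 2ρΣLⁱ + 2`, `toNat_le_width_of_sideTouches`);
`φ := 𝟙_S(A′ − A″)` satisfies the sourceless (1.38) at the cube member (`isLandau138_cube_of_univ_source`); file (U) `B8Ineq159CurvedCubeMemberUniform` at `m = k`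
with target `N_φ = N + C_φ s` (linearity of `J` — `Jcur_add` — and of the class averages — `linCovIter_sub_cubeLamBP`, [B7] Prop. 5 `norm_linCovIter_cubeLamBP_le`).

HONEST SCOPE ∕ A6.  PER MEMBER SHAPE (constants through (U)'s non-explicit `α₀(□), B″(□)`); NOT [4] Thm 3.3 with source; no knit hypothesis inhabited; no letter of [4]
assumed or proved.  Count-neutral; N05 NOT discharged; the YM mass gap (Clay) is NOT proved by any of this — R4 closes the conditional finite-`𝕋⁴` rung
`BalabanLadder.UV` only.  No `sorry`, no `def`, no `instance`, no `notation`.  Unit `pub-ymgap-dag-n05-w3` (g4), 2026-08-28.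
-/

noncomputable section

namespace Literature.MathematicalPhysics.QuantumFieldTheory.Balaban1983to89.B8Ineq159TopCubeTowerSourcePoint

open B7Prop1Explicit B7Prop2Explicit B7Prop1Local B7Eq78Linearization
open B7Prop4GeneralLevels (linCovIter)
open B7Prop5GeneralLevels (thetaGen)
open B8Ineq132 (covDerivFwd BondTouches InAk)
open B8Eq140Level (SideTouches sideTouches_of_bondTouches sideTouches_mono)
open B8Eq146AExpansion (iEta norm_I_eta_smul)
open B8Eq155JBound (Jcur)
open B8Eq138LandauZd (IsLandau138 QT covLap covDivB)
open B8Eq131CubesAdmissible (cubeFam cubeFam_true_zero cubeFam_false_zero cubeFam_false_of_le cubeFam_of_pos)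
open B8Eq131Cubes (cube cube_anti sqLo sqHi bLo bHi gs)
open B8CubeMemberZd (cubeLamS)
open B8Ineq159FlatCubeMemberPrinted (cubeLamBP cubeLamBP_box_subset_pred)
open B8Ineq159FlatCubeMemberPerCube (inBox_widen_of_sideTouches)
open B8TowerBondsPrinted (towerBondsP)
open B9Ineq3137LocalSup (linCovIter_congr)
open B9Eq316AveragingTransposeZd (alphaQ alphaQ_pos)
open B9SupplySockB9P3ZdSocketBoundaryMode (exists_ne_fin)
open B9SupplySockB9P3ZdLettersOmega (Jcur_add)
open B8Ineq159CurvedCubeMemberUniform (exists_curved159_perCube_inAk_sup_unitary_uniform)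
open B8Ineq159TopCubeTowerReads
open B8Ineq159TopCubeTowerSourceReads
open B8Prop7GlevZd3 (inAk_mono_alpha)

-- `Site` alone would resolve to the torus sites of `Setup.lean`; re-export the `ℤ^d` sites of `B7Prop1Explicit`.
export B7Prop1Explicit (Site)

variable {d : ℕ} {𝔹 : Type*} [CStarAlgebra 𝔹] [Nontrivial 𝔹]

/-! ## §1 Two reads -/

omit [Nontrivial 𝔹] in
/-- `iη(A − B) = iηA − iηB`. [cite: Balaban1985RegularSpaces, (1.36) p.82 (bookkeeping)] -/
theorem iEta_sub (η : ℝ) (A B : Site d → Fin d → 𝔹) : iEta η (A - B) = iEta η A - iEta η B := by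
  funext y κ
  simp only [iEta, Pi.sub_apply, smul_sub]

/-- **On the sides of the plaquettes touching `□₀` the coordinate `y_{i₀}` exceeds `□₀`'s lower corner by at most `LᵏM + 2ρ·gs L k + 1`** (`□₀ =
[Lᵏa − ρ·gs, Lᵏ(a+M) − 1 + ρ·gs]`, and such sides start in `[lo − 2, hi + 1]`). [cite: Balaban1985RegularSpaces, (1.131) p.99, p.98, p.77 (touching convention)] -/
theorem toNat_le_width_of_sideTouches (L : ℕ) (a : Site d) (M ρ k : ℕ) (i₀ : Fin d) {y : Site d} {τ : Fin d}
    (hs : SideTouches (cube L a M ρ k 0) y τ) :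
    (y i₀ - sqLo L a ρ k 0 i₀ + 1).toNat ≤ L ^ k * M + 2 * (ρ * gs L k) + 2 := by
  have hsub : cube L a M ρ k 0 ⊆ {x | InBox (sqLo L a ρ k 0) (sqHi L a M ρ k 0) x} := fun x hx => hx
  have hw2 : y i₀ ≤ sqHi L a M ρ k 0 i₀ + 1 := (inBox_widen_of_sideTouches (sideTouches_mono hsub hs) i₀).2
  have e1 : sqHi L a M ρ k 0 i₀ - sqLo L a ρ k 0 i₀ = ((L ^ k * M : ℕ) : ℤ) - 1 + 2 * ((ρ * gs L k : ℕ) : ℤ) := by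
    simp only [sqLo, sqHi, bLo, bHi, Nat.sub_zero]
    push_cast
    ring
  generalize hP : L ^ k * M = P at e1 ⊢
  generalize hR : ρ * gs L k = R at e1 ⊢
  omega

/-! ## §2 The pointwise bound -/

/-- ★★ **A FIELD IN THE SOURCED LANDAU GAUGE (1.146) OVER PRINT'S TOP-CUBE TOWER IS POINTWISE BOUNDED BY ITS CURRENT, ITS CLASS AVERAGES AND THE SOURCE.**
For `d ≥ 2`, `2 ≤ L ≤ ρ`, `k ≥ 1`, a finite-dimensional C⋆-algebra `𝔹`: `∃ cP3 ∈ (0, ½], P₀ ≥ 1, P₁ > 0` such that for every `a`, `η > 0`, `Λ` of print's shape,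
unitary `U₀ ∈ 𝔄_k(cP3)` over `(T, □₁, …, □_k)`, every `A′`, `f`, `s ≥ 0` with `η²|f| ≤ s`, `Δ_{U₀}(D^{η*}_{U₀}A′ − f) = Q^{T*}_Λμ` on `T`, and every `N ≥ 0`
dominating `(Lʲη)³|J(A′)|` on the bonds touching `Ω_j` and the class averages of `iηA′` on `towerBondsP`: `η|A′(b)| ≤ P₀N + P₁s` at every bond `b`, and
`(Lʲη)|A′(b)| ≤ P₀N + P₁s` for `b` a side of a plaquette touching `□_j`, `1 ≤ j ≤ k`.  PER MEMBER constants; NOT [4] Thm 3.3. [cite: Balaban1985RegularSpaces, (1.146) p.101, (1.57)–(1.59) p.86, (1.38) p.82, (1.131) p.99, (1.7) p.77; Balaban1985BackgroundPropagators, Thm 3.3 p.399; Balaban1985Averaging, Prop. 5 p.42] -/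
theorem exists_pointBound_src_topCube [FiniteDimensional ℂ 𝔹] (hd2 : 2 ≤ d) {L : ℕ} (hL2 : 2 ≤ L) (M : ℕ) {ρ : ℕ} (hρ : L ≤ ρ)
    {k : ℕ} (hk : 1 ≤ k) :
    ∃ cP3 P₀ P₁ : ℝ, 0 < cP3 ∧ cP3 ≤ 1 / 2 ∧ 1 ≤ P₀ ∧ 0 < P₁ ∧ ∀ (a : Site d) (η : ℝ), 0 < η →
      ∀ Λ : ℕ → Set (Site d), Λ 0 = (cube L a M ρ k 1)ᶜ → (∀ j, 1 ≤ j → j ≤ k → Λ j = cubeLamS L a M ρ k k j) →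
      ∀ U₀ : Site d → Fin d → 𝔹ˣ, (∀ x κ, U₀ x κ ∈ unitaryUnits 𝔹) → InAk L k η cP3 (cubeFam true L a M ρ k) U₀ →
      ∀ (A' : Site d → Fin d → 𝔹) (f : Site d → 𝔹) (s : ℝ), 0 ≤ s → (∀ x, ‖f x‖ ≤ s * (η ^ 2)⁻¹) →
      (∃ μ : ℕ → Site d → 𝔹, ∀ x, covLap η U₀ (fun z => covDivB η U₀ A' z - f z) x = QT L k Λ U₀ μ x) →
      ∀ N : ℝ, 0 ≤ N →
      (∀ j, j ≤ k → ∀ (x : Site d) (μ : Fin d), BondTouches (cubeFam true L a M ρ k j) x μ →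
        ((L : ℝ) ^ j * η) ^ 3 * ‖Jcur η U₀ A' μ x‖ ≤ N) →
      (∀ j, j ≤ k → ∀ c ∈ towerBondsP L (cubeFam true L a M ρ k) Λ j, ‖linCovIter L U₀ (iEta η A') j c.1 c.2‖ ≤ N) →
      (∀ (y : Site d) (τ : Fin d), η * ‖A' y τ‖ ≤ P₀ * N + P₁ * s) ∧
      (∀ j, 1 ≤ j → j ≤ k → ∀ (y : Site d) (τ : Fin d), SideTouches (cube L a M ρ k j) y τ →
        (L : ℝ) ^ j * η * ‖A' y τ‖ ≤ P₀ * N + P₁ * s) := by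
  classical
  obtain ⟨α₀, B'', hα₀, hB'', H⟩ := exists_curved159_perCube_inAk_sup_unitary_uniform (𝔹 := 𝔹) hd2 hL2 M hρ (k := k) (m := k) hk le_rfl
  have hL1 : 1 ≤ L := le_trans (by norm_num) hL2
  have hρ1 : 1 ≤ ρ := hL1.trans hρ
  have hL1r : (1 : ℝ) ≤ L := by exact_mod_cast hL1
  have hLk1 : (1 : ℝ) ≤ (L : ℝ) ^ k := one_le_pow₀ hL1r
  have hd1 : (1 : ℝ) ≤ d := by exact_mod_cast (le_trans (by norm_num) hd2 : 1 ≤ d)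
  -- the constants
  obtain ⟨cP3, hcP3⟩ : ∃ c : ℝ, c = min (min α₀ (1 / 2)) (alphaQ d L / (L : ℝ) ^ 2) := ⟨_, rfl⟩
  have hcP3pos : 0 < cP3 := by rw [hcP3]; exact lt_min (lt_min hα₀ (by norm_num)) (div_pos (alphaQ_pos d hL1) (by positivity))
  have hcP3α : cP3 ≤ α₀ := by rw [hcP3]; exact (min_le_left _ _).trans (min_le_left _ _)
  have hcP3h : cP3 ≤ 1 / 2 := by rw [hcP3]; exact (min_le_left _ _).trans (min_le_right _ _)
  have hcP3Q : cP3 * (L : ℝ) ^ 2 ≤ alphaQ d L := by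
    have h : cP3 ≤ alphaQ d L / (L : ℝ) ^ 2 := by rw [hcP3]; exact min_le_right _ _
    calc cP3 * (L : ℝ) ^ 2 ≤ alphaQ d L / (L : ℝ) ^ 2 * (L : ℝ) ^ 2 := mul_le_mul_of_nonneg_right h (by positivity)
      _ = alphaQ d L := div_mul_cancel₀ _ (by positivity)
  have hθ0 : 0 ≤ thetaGen d L (cP3 * (L : ℝ) ^ 2) := by unfold thetaGen; positivity
  obtain ⟨Wd, hWd⟩ : ∃ w : ℝ, w = ((L ^ k * M + 2 * (ρ * gs L k) + 2 : ℕ) : ℝ) := ⟨_, rfl⟩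
  have hWd0 : 0 ≤ Wd := by rw [hWd]; positivity
  obtain ⟨Cφ, hCφ⟩ : ∃ c : ℝ, c = 16 * d * (1 + thetaGen d L (cP3 * (L : ℝ) ^ 2)) * ((L : ℝ) ^ k) ^ 3 * Wd := ⟨_, rfl⟩
  have hCφ0 : 0 ≤ Cφ := by rw [hCφ]; positivity
  have h16 : (1 : ℝ) ≤ 16 * d * (1 + thetaGen d L (cP3 * (L : ℝ) ^ 2)) * ((L : ℝ) ^ k) ^ 3 :=
    one_le_mul_of_one_le_of_one_le (one_le_mul_of_one_le_of_one_le (by linarith) (by linarith)) (one_le_pow₀ hLk1)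
  have hWdC : Wd ≤ Cφ := by
    rw [hCφ]
    calc Wd = 1 * Wd := (one_mul _).symm
      _ ≤ 16 * d * (1 + thetaGen d L (cP3 * (L : ℝ) ^ 2)) * ((L : ℝ) ^ k) ^ 3 * Wd := mul_le_mul_of_nonneg_right h16 hWd0
  have hC16 : 16 * d * ((L : ℝ) ^ k) ^ 3 * Wd ≤ Cφ := by
    rw [hCφ]
    have h1 : 16 * (d : ℝ) * ((L : ℝ) ^ k) ^ 3 * Wd * 1 ≤ 16 * d * ((L : ℝ) ^ k) ^ 3 * Wd * (1 + thetaGen d L (cP3 * (L : ℝ) ^ 2)) :=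
      mul_le_mul_of_nonneg_left (by linarith) (by positivity)
    linarith
  have hC2 : ∀ j, j ≤ k → 2 * d * ((1 + thetaGen d L (cP3 * (L : ℝ) ^ 2)) * (L : ℝ) ^ j) * Wd ≤ Cφ := by
    intro j hj
    have hLj : (L : ℝ) ^ j ≤ ((L : ℝ) ^ k) ^ 3 := (pow_le_pow_right₀ hL1r hj).trans (le_self_pow₀ hLk1 (by norm_num))
    rw [hCφ]
    calc 2 * (d : ℝ) * ((1 + thetaGen d L (cP3 * (L : ℝ) ^ 2)) * (L : ℝ) ^ j) * Wd
        = 2 * ((d : ℝ) * (1 + thetaGen d L (cP3 * (L : ℝ) ^ 2)) * Wd * (L : ℝ) ^ j) := by ring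
      _ ≤ 16 * ((d : ℝ) * (1 + thetaGen d L (cP3 * (L : ℝ) ^ 2)) * Wd * ((L : ℝ) ^ k) ^ 3) := by gcongr; norm_num
      _ = 16 * d * (1 + thetaGen d L (cP3 * (L : ℝ) ^ 2)) * ((L : ℝ) ^ k) ^ 3 * Wd := by ring
  obtain ⟨P₀, hP₀⟩ : ∃ p : ℝ, p = B'' + 1 := ⟨_, rfl⟩
  have hP₀0 : 0 < P₀ := by rw [hP₀]; positivity
  have hBP : B'' ≤ P₀ := by rw [hP₀]; linarith
  have h1P : 1 ≤ P₀ := by rw [hP₀]; linarith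
  obtain ⟨P₁, hP₁⟩ : ∃ p : ℝ, p = B'' * Cφ + (L : ℝ) ^ k * Wd + 1 := ⟨_, rfl⟩
  have hP₁0 : 0 < P₁ := by rw [hP₁]; positivity
  have hP₁b : B'' * Cφ + (L : ℝ) ^ k * Wd ≤ P₁ := by rw [hP₁]; linarith
  refine ⟨cP3, P₀, P₁, hcP3pos, hcP3h, h1P, hP₁0, ?_⟩
  intro a η hη Λ hΛ0 hΛ U₀ hU₀ hAkc A' f s hs0 hfpt hLan' N hN0 hNJ hNavg
  have hU1 : ∀ x κ, U₀ x κ ∈ U1 𝔹 := fun x κ => unitaryUnits_le_U1 (hU₀ x κ)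
  have hηne : η ≠ 0 := hη.ne'
  have hAk0 : InAk L k η α₀ (cubeFam true L a M ρ k) U₀ := inAk_mono_alpha hη hcP3α hAkc
  have hsub : cubeFam false L a M ρ k 0 ⊆ cubeFam true L a M ρ k 0 := by rw [cubeFam_true_zero]; exact Set.subset_univ _
  have hbt : ∀ (y : Site d) (τ : Fin d), BondTouches (cube L a M ρ k 0) y τ → SideTouches (cube L a M ρ k 0) y τ := fun y τ hb => by
    obtain ⟨κ, hκ⟩ := exists_ne_fin hd2 τ
    exact sideTouches_of_bondTouches hκ hb
  -- (1) the divergence potential of `f` along `e₀` from `□₀`'s lower face, cut off to the sides `S` of the plaquettes touching `□₀`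
  obtain ⟨i₀, hi₀⟩ : ∃ i : Fin d, i = ⟨0, by omega⟩ := ⟨_, rfl⟩
  obtain ⟨A'', -, -, hdivA, hAbnd⟩ := exists_divPotential hη hU1 i₀ (sqLo L a ρ k 0 i₀) f (b := s * (η ^ 2)⁻¹) (by positivity) hfpt
  obtain ⟨A3, hA3⟩ : ∃ B : Site d → Fin d → 𝔹, B = fun y τ => if SideTouches (cube L a M ρ k 0) y τ then A'' y τ else 0 := ⟨_, rfl⟩
  have hA3S : ∀ (y : Site d) (τ : Fin d), SideTouches (cube L a M ρ k 0) y τ → A3 y τ = A'' y τ := fun y τ h => by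
    rw [hA3]; exact if_pos h
  have hA3N : ∀ (y : Site d) (τ : Fin d), ¬ SideTouches (cube L a M ρ k 0) y τ → A3 y τ = 0 := fun y τ h => by
    rw [hA3]; exact if_neg h
  have hA3η : ∀ (y : Site d) (τ : Fin d), η * ‖A3 y τ‖ ≤ Wd * s := by
    intro y τ
    by_cases h : SideTouches (cube L a M ρ k 0) y τ
    · rw [hA3S y τ h]
      have hw : ((y i₀ - sqLo L a ρ k 0 i₀ + 1).toNat : ℝ) ≤ Wd := by
        rw [hWd]; exact_mod_cast toNat_le_width_of_sideTouches L a M ρ k i₀ h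
      calc η * ‖A'' y τ‖ ≤ η * (((y i₀ - sqLo L a ρ k 0 i₀ + 1).toNat : ℝ) * (η * (s * (η ^ 2)⁻¹))) :=
            mul_le_mul_of_nonneg_left (hAbnd y τ) hη.le
        _ = ((y i₀ - sqLo L a ρ k 0 i₀ + 1).toNat : ℝ) * s := by field_simp
        _ ≤ Wd * s := mul_le_mul_of_nonneg_right hw hs0
    · rw [hA3N y τ h, norm_zero, mul_zero]; positivity
  have hA3b : ∀ (y : Site d) (τ : Fin d), ‖A3 y τ‖ ≤ Wd * s * η⁻¹ := fun y τ => by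
    rw [le_mul_inv_iff₀ hη, mul_comm]; exact hA3η y τ
  have hdiv3 : ∀ x, x ∈ cube L a M ρ k 0 → covDivB η U₀ A3 x = f x := by
    intro x hx
    rw [← hdivA x (hx i₀).1]
    exact covDivB_congr_fld x (fun ν => hA3S _ _ (hbt _ _ (Or.inr (by rw [sub_add_cancel]; exact hx))))
      (fun ν => hA3S _ _ (hbt _ _ (Or.inl hx)))
  -- (2) `φ := 𝟙_S(A′ − A″)` is in the cube member's (sourceless) Landau gauge
  obtain ⟨φ, hφ⟩ : ∃ B : Site d → Fin d → 𝔹, B = fun y τ => if SideTouches (cube L a M ρ k 0) y τ then A' y τ - A3 y τ else 0 := ⟨_, rfl⟩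
  have hφS : ∀ (y : Site d) (τ : Fin d), SideTouches (cube L a M ρ k 0) y τ → φ y τ = A' y τ - A3 y τ := fun y τ h => by
    rw [hφ]; exact if_pos h
  have hφN : ∀ (y : Site d) (τ : Fin d), ¬ SideTouches (cube L a M ρ k 0) y τ → φ y τ = 0 := fun y τ h => by
    rw [hφ]; exact if_neg h
  have hφS' : ∀ (y : Site d) (τ : Fin d), SideTouches (cube L a M ρ k 0) y τ → φ y τ = (A' - A3) y τ := fun y τ h => by
    rw [hφS y τ h, Pi.sub_apply, Pi.sub_apply]
  have hLanφ : IsLandau138 L k η (cubeFam false L a M ρ k 0) (cubeLamS L a M ρ k k) U₀ φ :=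
    isLandau138_cube_of_univ_source hL1 a M hρ1 hk hΛ0 hΛ (A := A') (A' := φ) (A'' := A3)
      (fun y τ hb => hφS y τ (hbt y τ hb)) hdiv3 hLan'
  have hφ0 : ∀ (y : Site d) (τ : Fin d), (∀ j, j ≤ k → ¬ SideTouches (cubeFam false L a M ρ k j) y τ) → φ y τ = 0 := fun y τ h =>
    hφN y τ (by have h0 := h 0 (Nat.zero_le k); rwa [cubeFam_false_zero] at h0)
  -- (3) the current and the class averages of the cut-off potential
  have hJ3 : ∀ (μ : Fin d) (x : Site d), ‖Jcur η U₀ A3 μ x‖ ≤ 8 * d * (η⁻¹ * (η⁻¹ * (Wd * s * η⁻¹ + Wd * s * η⁻¹))) := by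
    intro μ x
    refine B9SupplySockB9P3Zd.norm_Jcur_le_of_grad hη hU1 (fun y κ τ => ?_) μ x
    exact (B8Ineq159StencilsNearFlat.norm_covDerivFwd_le hU1 hη κ (fun z => A3 z τ) y).trans
      (mul_le_mul_of_nonneg_left (add_le_add (hA3b _ _) (hA3b _ _)) (inv_nonneg.2 hη.le))
  have hJ3w : ∀ j, j ≤ k → ∀ (μ : Fin d) (x : Site d), ((L : ℝ) ^ j * η) ^ 3 * ‖Jcur η U₀ A3 μ x‖ ≤ Cφ * s := by
    intro j hj μ x
    have hLj : (L : ℝ) ^ j ≤ (L : ℝ) ^ k := pow_le_pow_right₀ hL1r hj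
    calc ((L : ℝ) ^ j * η) ^ 3 * ‖Jcur η U₀ A3 μ x‖
        ≤ ((L : ℝ) ^ k * η) ^ 3 * (8 * d * (η⁻¹ * (η⁻¹ * (Wd * s * η⁻¹ + Wd * s * η⁻¹)))) :=
          mul_le_mul (pow_le_pow_left₀ (by positivity) (mul_le_mul_of_nonneg_right hLj hη.le) 3) (hJ3 μ x) (norm_nonneg _) (by positivity)
      _ = 16 * d * ((L : ℝ) ^ k) ^ 3 * Wd * s := by field_simp; ring
      _ ≤ Cφ * s := mul_le_mul_of_nonneg_right hC16 hs0
  have hiA3 : ∀ (y : Site d) (μ : Fin d), ‖iEta η A3 y μ‖ ≤ Wd * s := fun y μ => by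
    rw [iEta, norm_I_eta_smul hη.le]; exact hA3η y μ
  have havg3 : ∀ j, 1 ≤ j → j ≤ k → ∀ c ∈ cubeLamBP L a M ρ k k j, ‖linCovIter L U₀ (iEta η A3) j c.1 c.2‖ ≤ Cφ * s := by
    intro j hj1 hjk c hc
    calc ‖linCovIter L U₀ (iEta η A3) j c.1 c.2‖ ≤ 2 * d * ((1 + thetaGen d L (cP3 * (L : ℝ) ^ 2)) * (L : ℝ) ^ j) * (Wd * s) :=
          norm_linCovIter_cubeLamBP_le hL2 hρ hcP3pos hcP3Q hU₀ hAkc hj1 hjk hc (iEta η A3) (mul_nonneg hWd0 hs0) (fun y μ _ => hiA3 y μ)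
      _ = 2 * d * ((1 + thetaGen d L (cP3 * (L : ℝ) ^ 2)) * (L : ℝ) ^ j) * Wd * s := by ring
      _ ≤ Cφ * s := mul_le_mul_of_nonneg_right (hC2 j hjk) hs0
  -- (4) file (U)'s hypotheses for `φ` with the target `N_φ = N + C_φ s`
  have hNφ0 : 0 ≤ N + Cφ * s := by positivity
  have HJ : ∀ j, j ≤ k → ∀ (y : Site d) (τ : Fin d), BondTouches (cubeFam false L a M ρ k j) y τ →
      ((L : ℝ) ^ j * η) ^ 3 * ‖Jcur η U₀ φ τ y‖ ≤ N + Cφ * s := by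
    intro j hj y τ hb
    rw [cubeFam_false_of_le L a M ρ hj] at hb
    have hb0 : BondTouches (cube L a M ρ k 0) y τ := by
      rcases hb with h | h
      exacts [Or.inl (cube_anti (Nat.zero_le j) hj h), Or.inr (cube_anti (Nat.zero_le j) hj h)]
    have hbΩ : BondTouches (cubeFam true L a M ρ k j) y τ := by
      rcases Nat.eq_zero_or_pos j with rfl | hj1
      · rw [cubeFam_true_zero]; exact Or.inl (Set.mem_univ y)
      · rwa [cubeFam_of_pos true L a M ρ hj1 hj]
    have hsplit : Jcur η U₀ (A' - A3) τ y = Jcur η U₀ A' τ y - Jcur η U₀ A3 τ y := by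
      rw [eq_sub_iff_add_eq, ← Jcur_add, sub_add_cancel]
    rw [Jcur_congr_fld_touch hb0 hφS', hsplit]
    calc ((L : ℝ) ^ j * η) ^ 3 * ‖Jcur η U₀ A' τ y - Jcur η U₀ A3 τ y‖
        ≤ ((L : ℝ) ^ j * η) ^ 3 * (‖Jcur η U₀ A' τ y‖ + ‖Jcur η U₀ A3 τ y‖) := mul_le_mul_of_nonneg_left (norm_sub_le _ _) (by positivity)
      _ ≤ N + Cφ * s := by rw [mul_add]; exact add_le_add (hNJ j hj y τ hbΩ) (hJ3w j hj τ y)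
  have Havg : ∀ j, j ≤ k → ∀ c ∈ cubeLamBP L a M ρ k k j, ‖linCovIter L U₀ (iEta η φ) j c.1 c.2‖ ≤ N + Cφ * s := by
    intro j hj c hc
    rcases Nat.eq_zero_or_pos j with rfl | hj1
    · have hb0 : BondTouches (cube L a M ρ k 0) c.1 c.2 := by obtain ⟨-, hends, -⟩ := hc; exact hends
      have e0 : linCovIter L U₀ (iEta η φ) 0 c.1 c.2 = iEta η A' c.1 c.2 - iEta η A3 c.1 c.2 := by
        show iEta η φ c.1 c.2 = _
        rw [iEta, iEta, iEta, hφS c.1 c.2 (hbt _ _ hb0), smul_sub]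
      rw [e0]
      refine (norm_sub_le _ _).trans (add_le_add ?_ ((hiA3 c.1 c.2).trans (mul_le_mul_of_nonneg_right hWdC hs0)))
      exact hNavg 0 hj c (cubeLamBP_zero_subset_towerBondsP hL1 a M ρ hk hΛ0 hc)
    · have hjk : j - 1 ≤ k := by omega
      have e1 : linCovIter L U₀ (iEta η φ) j c.1 c.2 = linCovIter L U₀ (iEta η (A' - A3)) j c.1 c.2 :=
        linCovIter_congr L hL1 j c.1 c.2 (fun _ _ _ _ => rfl) fun z κ hz _ => by
          simp only [iEta, hφS' z κ (hbt _ _ (Or.inl (cube_anti (Nat.zero_le _) hjk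
            (cubeLamBP_box_subset_pred hL1 a M hρ hj1 le_rfl hc z hz))))]
      rw [e1, iEta_sub, linCovIter_sub_cubeLamBP hL2 hρ hcP3pos hcP3Q hU₀ hAkc hj1 hj hc]
      refine (norm_sub_le _ _).trans (add_le_add ?_ (havg3 j hj1 hj c hc))
      exact hNavg j hj c (cubeLamBP_subset_towerBondsP_topCube_of_le hL1 a M hρ hΛ0 hΛ hj1 hj hc)
  have Hout : ∀ (y : Site d) (τ : Fin d), ¬ BondTouches (cubeFam false L a M ρ k 0) y τ → η * ‖φ y τ‖ ≤ N + Cφ * s := by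
    intro y τ hnb
    rw [cubeFam_false_zero] at hnb
    by_cases hsd : SideTouches (cube L a M ρ k 0) y τ
    · rw [hφS y τ hsd]
      have h1 : η * ‖A' y τ‖ ≤ N := by
        rw [← norm_I_eta_smul hη.le]
        exact hNavg 0 (Nat.zero_le k) (y, τ) (mem_towerBondsP_zero_of_not_bondTouches L a M ρ hk hΛ0 hnb)
      calc η * ‖A' y τ - A3 y τ‖ ≤ η * (‖A' y τ‖ + ‖A3 y τ‖) := mul_le_mul_of_nonneg_left (norm_sub_le _ _) hη.le
        _ ≤ N + Cφ * s := by rw [mul_add]; exact add_le_add h1 ((hA3η y τ).trans (mul_le_mul_of_nonneg_right hWdC hs0))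
    · rw [hφN y τ hsd, norm_zero, mul_zero]; exact hNφ0
  -- (5) the per-member curved (1.59) for `φ`; the pointwise bounds for `A′ = φ + A‴` on `S`, `η|A′| ≤ N` off `□₁`
  have hmain := H a η hη U₀ hU₀ (cubeFam true L a M ρ k) k hsub hAk0 φ hLanφ hφ0 (N + Cφ * s) hNφ0 HJ Havg Hout
  have LEV : ∀ j, 1 ≤ j → j ≤ k → ∀ (y : Site d) (τ : Fin d), SideTouches (cube L a M ρ k j) y τ →
      (L : ℝ) ^ j * η * ‖A' y τ‖ ≤ B'' * N + (B'' * Cφ + (L : ℝ) ^ k * Wd) * s := by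
    intro j hj1 hjk y τ hs
    have hsf : SideTouches (cubeFam false L a M ρ k j) y τ := by rwa [cubeFam_false_of_le L a M ρ hjk]
    have hs0 : SideTouches (cube L a M ρ k 0) y τ := sideTouches_mono (cube_anti (Nat.zero_le j) hjk) hs
    have hA'eq : A' y τ = φ y τ + A3 y τ := by rw [hφS y τ hs0, sub_add_cancel]
    have hA3w : (L : ℝ) ^ j * η * ‖A3 y τ‖ ≤ (L : ℝ) ^ k * (Wd * s) := by
      rw [mul_assoc]; exact mul_le_mul (pow_le_pow_right₀ hL1r hjk) (hA3η y τ) (by positivity) (by positivity)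
    calc (L : ℝ) ^ j * η * ‖A' y τ‖ = (L : ℝ) ^ j * η * ‖φ y τ + A3 y τ‖ := by rw [← hA'eq]
      _ ≤ (L : ℝ) ^ j * η * (‖φ y τ‖ + ‖A3 y τ‖) := mul_le_mul_of_nonneg_left (norm_add_le _ _) (by positivity)
      _ ≤ B'' * (N + Cφ * s) + (L : ℝ) ^ k * (Wd * s) := by rw [mul_add]; exact add_le_add (hmain j hjk y τ hsf).1 hA3w
      _ = B'' * N + (B'' * Cφ + (L : ℝ) ^ k * Wd) * s := by ring
  refine ⟨fun y τ => ?_, fun j hj1 hjk y τ hs => (LEV j hj1 hjk y τ hs).trans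
    (add_le_add (mul_le_mul_of_nonneg_right hBP hN0) (mul_le_mul_of_nonneg_right hP₁b hs0))⟩
  by_cases hb1 : BondTouches (cube L a M ρ k 1) y τ
  · obtain ⟨κ, hκ⟩ := exists_ne_fin hd2 τ
    have h := LEV 1 le_rfl hk y τ (sideTouches_of_bondTouches hκ hb1)
    rw [pow_one] at h
    calc η * ‖A' y τ‖ ≤ (L : ℝ) * η * ‖A' y τ‖ := by rw [mul_assoc]; exact le_mul_of_one_le_left (by positivity) hL1r
      _ ≤ B'' * N + (B'' * Cφ + (L : ℝ) ^ k * Wd) * s := h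
      _ ≤ P₀ * N + P₁ * s := add_le_add (mul_le_mul_of_nonneg_right hBP hN0) (mul_le_mul_of_nonneg_right hP₁b hs0)
  · have h1 : y ∉ cube L a M ρ k 1 := fun h => hb1 (Or.inl h)
    have h2 : y + e τ ∉ cube L a M ρ k 1 := fun h => hb1 (Or.inr h)
    have h := hNavg 0 (Nat.zero_le k) (y, τ) (mem_towerBondsP_zero_of_ends L a M ρ k hΛ0 h1 h2)
    have e0 : linCovIter L U₀ (iEta η A') 0 (y, τ).1 (y, τ).2 = ((Complex.I : ℂ) * η) • A' y τ := rfl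
    rw [e0, norm_I_eta_smul hη.le] at h
    calc η * ‖A' y τ‖ ≤ N := h
      _ ≤ P₀ * N := le_mul_of_one_le_left hN0 h1P
      _ ≤ P₀ * N + P₁ * s := le_add_of_nonneg_right (by positivity)

end Literature.MathematicalPhysics.QuantumFieldTheory.Balaban1983to89.B8Ineq159TopCubeTowerSourcePoint

end
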